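import Summits.HodgeConjecture.HodgeConjecture.Theorems.VHCAbelianSchemesRoadPsiStableCoreFinite
import Literature.AlgebraicGeometry.Motives.AbelianVarietyManinMumfordRaynaud
import HarnessLib

/-!
# Road №4 (`VHCAbelianSchemesRoad`) — MOVER CONFINEMENT AT A K-SIMPLE DATUM: stub (S2) `stub_moverConfinement_of_KSimple` of line `mover-trap`
# (crux stmt-HodgeConjecture-26512), step (L-B)⁻ — the assembly over the two remaining kernel inputs of the cut (P1 cofinite annihilator, P2 ψ̄ arithmetic)

research route conditional on HC_CM; not a corollary; Q11.4-sentence-2 already refuted in dim ≥ 3.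

PROOFS ONLY (core-w5 gen 3, width copy of seat core-D; helper `--supports stmt-HodgeConjecture-26512`; `HC_CM` nowhere; ZERO new named facts —
`Raynaud1983_maninMumford` (p626314) is a NAMED FACT and stays the ANTECEDENT of the theorem, exactly as in the registered stub; nothing about any cell,
stub of `birth.lean`, crux, carrier, `HC_AV` or HC is asserted). The k0 memo `Cruxes/DiagLocalOfMarkmanPinnedForall/Lines/MoverTrap-S2-K0.md` cut
(S2) into (L-A) — the ψ̄-stable core is finite at a K-simple datum, LANDED (`VHCAbelianSchemesRoadPsiStableCoreFinite`, p666508) over the cofinite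
annihilator (piece P1, `AbelianVariety.exists_cofinite_annihilator_of_range_ne_univ`, Literature) — and (L-B), the assembly. This file is (L-B) with
the two outstanding kernel inputs DISPLAYED AS HYPOTHESES of their frozen shapes: `hA1` = P1's conclusion for every homomorphism into `Y`, and `hP2` =
piece P2's mover points arithmetic («a mover `g` for `m` kills `x` ⇒ `ψ̄ x = x^{-m}` and `x^{m²+d} = 1`», `VHCAbelianSchemesRoadSecantQuotientPsiBar`).
The VERBATIM (S2) statement follows from `moverConfinement_of_KSimple_of` by two `obtain`s once P1 and P2 are in the tree (appended then; nothing
here is conditional on anything but those two kernel-class lemmas and Raynaud BY NAME).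

Proof (memo §2): Raynaud ONCE on `(Y, V, ι)` — finitely many torsion cosets `tᵢ · fᵢ(Bᵢ(ℂ)) ⊆ V(ℂ)` covering the torsion of `V(ℂ)`; `V(ℂ) ≠ Y(ℂ)`
makes each `fᵢ` non-surjective on points; (L-A) makes each `Sᵢ = {y ∈ ⟨tᵢ⟩·fᵢ(Bᵢ(ℂ)) | ψ̄ y ∈ ⟨tᵢ⟩·fᵢ(Bᵢ(ℂ))}` finite; `T :=` the orders `> 1` of
the points of `⋃ᵢ Sᵢ`. A kernel point `x ≠ 1` of a mover `ḡ_{u_m}` with `m² + d` prime to `T`, lying on `V(ℂ)`: `x^{m²+d} = 1` so `x` is torsion and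
`orderOf x ∣ m² + d`; Raynaud puts `x` on a coset, `ψ̄ x = x^{-m}` puts it in `Sᵢ`; so `1 < orderOf x ∈ T` divides `m² + d` — contradiction.

Nothing here says (S2), (c4a-E), (c4a), any stub of `birth.lean`, 26512, 26511, №4, `HC_AV`, `HC_CM` or HC holds; HC_CM HELD, by name only.

References: [cite: Raynaud1983SousVarietes, Théorème principal (p. 327)] [cite: MumfordAV1970, §7 Thm. 4 (p. 72), §19 Thm. 1 (pp. 173–174)]
[cite: BirkenhakeLange2004, §5.3 and §13.4] [cite: Markman2025SecantWeil, §1.5 (p. 7) and §9.3 Lemma 9.3.3].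
-/

noncomputable section

universe u

open CategoryTheory CategoryTheory.Limits AlgebraicGeometry

namespace Summit.HodgeConjecture.HodgeConjecture.Ring2.SemiregularRepresentatives

set_option linter.dupNamespace false -- the cell's namespace repeats the summit name, as in every `Ring2*` file

open Literature.AlgebraicGeometry Literature.AlgebraicGeometry.Motives Literature.AlgebraicGeometry.Motives.AbelianVariety
open Literature.AlgebraicGeometry.HodgeTheory Literature.AlgebraicGeometry.Markman2025

namespace MoverTrap

open SecantQuotientDatum

/-- **(L-B)⁻ — MOVER CONFINEMENT AT A K-SIMPLE DATUM, over the two kernel inputs of the cut** (k0 memo §2 steps 1–5): Raynaud's theorem BY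
NAME (`Raynaud1983_maninMumford`, applied ONCE to `(D.Y, V, ι)`), K-simplicity of the datum, a descent `ψ̄` of `φ_d` to `Y`, the COFINITE
ANNIHILATOR input `hA1` (shape of `AbelianVariety.exists_cofinite_annihilator_of_range_ne_univ`, piece P1) and the MOVER POINTS ARITHMETIC input
`hP2` («a mover `g` for `m` kills `x` ⇒ `ψ̄ x = x^{-m}` and `x^{m²+d} = 1`», piece P2) GIVE the conclusion of stub (S2) `stub_moverConfinement_of_KSimple`:
a finite set `T` of orders `> 1` off which no mover `ḡ_{u_m}` has a kernel point `≠ 1` on `V`. Proof: Raynaud covers the torsion points of `V(ℂ)`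
by finitely many torsion cosets `tᵢ · fᵢ(Bᵢ(ℂ)) ⊆ V(ℂ)`; `V(ℂ) ≠ Y(ℂ)` makes each `fᵢ` non-surjective on points; the ψ̄-stable cores
`Sᵢ = {y ∈ ⟨tᵢ⟩·fᵢ(Bᵢ(ℂ)) | ψ̄ y ∈ ⟨tᵢ⟩·fᵢ(Bᵢ(ℂ))}` are finite (`finite_psiBarStableCore_of_exists_annihilator`, (L-A)); `T :=` the orders `> 1`
of the points of `⋃ᵢ Sᵢ`; a kernel point `x ≠ 1` of a good mover lying on `V(ℂ)` is torsion (`x^{m²+d} = 1`), hence on some coset, hence in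
`Sᵢ` (as `ψ̄ x = x^{-m}`), so `orderOf x ∈ T` divides `m² + d` — excluded. [cite: Raynaud1983SousVarietes, Théorème principal (p. 327)]
[cite: MumfordAV1970, §7 Thm. 4 (p. 72) and §19 Thm. 1] [cite: BirkenhakeLange2004, §5.3 and §13.4] [cite: Markman2025SecantWeil, §9.3 Lemma 9.3.3] -/
theorem moverConfinement_of_KSimple_of (hR : Raynaud1983_maninMumford) (D : SecantQuotientDatum) (hK : KSimple D)
    {ψbar : D.Y ⟶ D.Y} (hψbar : D.q ≫ ψbar = D.ψ ≫ D.q)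
    (hA1 : ∀ (C : AbelianVariety ℂ) (g : C ⟶ D.Y), Set.range (pointsMap ℂ g) ≠ Set.univ →
      ∃ (Z : AbelianVariety ℂ) (π : D.Y ⟶ Z) (N : ℕ), π ≠ 0 ∧ g ≫ π = 0 ∧ 0 < N ∧
        ∀ y : D.Y.Points ℂ, pointsMap ℂ π y = 1 → y ^ N ∈ Set.range (pointsMap ℂ g))
    (hP2 : ∀ (m : ℤ) (g : D.Y ⟶ D.Y), D.IsMover m g → ∀ x : D.Y.Points ℂ, x ∈ Hom.kerPoints (specOver ℂ ℂ) g →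
      pointsMap ℂ ψbar x = (x ^ m)⁻¹ ∧ x ^ (m ^ 2 + (D.d : ℤ)) = 1)
    (V : SchemeOver ℂ) (ι : V ⟶ D.Y.X) (hι : IsClosedImmersion ι.left) (hV : Set.range (AlgPoints.map (L := ℂ) ι) ≠ Set.univ) :
    ∃ T : Finset ℕ, (∀ N ∈ T, 1 < N) ∧
      ∀ (m : ℤ) (g : D.Y ⟶ D.Y), D.IsMover m g → (∀ N ∈ T, ¬ ((N : ℤ) ∣ m ^ 2 + (D.d : ℤ))) →
        ∀ x : D.Y.Points ℂ, x ∈ Hom.kerPoints (specOver ℂ ℂ) g → x ≠ 1 → x ∉ Set.range (AlgPoints.map (L := ℂ) ι) := by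
  classical
  obtain ⟨n, t, B, f, htors, hsub, hcover⟩ := hR D.Y V ι hι
  -- each Raynaud homomorphism `f i` is NOT surjective on complex points (its torsion coset lies in `V(ℂ) ≠ Y(ℂ)`)
  have hf : ∀ i, Set.range (pointsMap ℂ (f i)) ≠ Set.univ := by
    intro i hEq
    apply hV
    refine Set.eq_univ_of_forall fun x => ?_
    obtain ⟨Q, hQ⟩ : (t i)⁻¹ * x ∈ Set.range (pointsMap ℂ (f i)) := hEq ▸ Set.mem_univ _
    have hmem := hsub i Q
    rwa [← pointsMap_apply, hQ, mul_inv_cancel_left] at hmem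
  -- the ψ̄-stable cores are finite, (L-A)
  have hS : ∀ i, {y : D.Y.Points ℂ | y ∈ Subgroup.zpowers (t i) ⊔ (pointsMap ℂ (f i)).range ∧
      pointsMap ℂ ψbar y ∈ Subgroup.zpowers (t i) ⊔ (pointsMap ℂ (f i)).range}.Finite := fun i =>
    D.finite_psiBarStableCore_of_exists_annihilator hK hψbar (f i) (hA1 _ (f i) (hf i)) (t i) (htors i)
  have hM : (⋃ i, {y : D.Y.Points ℂ | y ∈ Subgroup.zpowers (t i) ⊔ (pointsMap ℂ (f i)).range ∧
      pointsMap ℂ ψbar y ∈ Subgroup.zpowers (t i) ⊔ (pointsMap ℂ (f i)).range}).Finite := Set.finite_iUnion hS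
  refine ⟨(hM.toFinset.image orderOf).filter (fun N => 1 < N), fun N hN => (Finset.mem_filter.1 hN).2, ?_⟩
  intro m g hg hgood x hx hx1 hxV
  obtain ⟨hψx, hxpow⟩ := hP2 m g hg x hx
  have hN0 : m ^ 2 + (D.d : ℤ) ≠ 0 := by
    have h4 : (4 : ℤ) ≤ (D.d : ℤ) := by exact_mod_cast D.four_le
    nlinarith [sq_nonneg m]
  have hdvd : (orderOf x : ℤ) ∣ m ^ 2 + (D.d : ℤ) := orderOf_dvd_iff_zpow_eq_one.2 hxpow
  have hfin : IsOfFinOrder x := by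
    rw [← orderOf_pos_iff, Nat.pos_iff_ne_zero]
    intro h0
    rw [h0, Nat.cast_zero, zero_dvd_iff] at hdvd
    exact hN0 hdvd
  -- Raynaud: the torsion point `x` of `V(ℂ)` lies on a torsion coset
  obtain ⟨i, Q, hxQ⟩ := hcover x hfin hxV
  have hxH : x ∈ Subgroup.zpowers (t i) ⊔ (pointsMap ℂ (f i)).range :=
    Subgroup.mem_sup.2 ⟨t i, Subgroup.mem_zpowers _, pointsMap ℂ (f i) Q, ⟨Q, rfl⟩, by rw [hxQ, pointsMap_apply]⟩
  have hψH : pointsMap ℂ ψbar x ∈ Subgroup.zpowers (t i) ⊔ (pointsMap ℂ (f i)).range := by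
    rw [hψx]
    exact inv_mem (zpow_mem hxH m)
  have hxM : x ∈ ⋃ i, {y : D.Y.Points ℂ | y ∈ Subgroup.zpowers (t i) ⊔ (pointsMap ℂ (f i)).range ∧
      pointsMap ℂ ψbar y ∈ Subgroup.zpowers (t i) ⊔ (pointsMap ℂ (f i)).range} := Set.mem_iUnion.2 ⟨i, hxH, hψH⟩
  have ho1 : 1 < orderOf x := by
    rcases Nat.lt_or_ge 1 (orderOf x) with h | h
    · exact h
    · exfalso
      have hpos := hfin.orderOf_pos
      have : orderOf x = 1 := by omega
      exact hx1 (orderOf_eq_one_iff.1 this)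
  exact hgood (orderOf x) (Finset.mem_filter.2 ⟨Finset.mem_image.2 ⟨x, hM.mem_toFinset.2 hxM, rfl⟩, ho1⟩) hdvd

end MoverTrap

end Summit.HodgeConjecture.HodgeConjecture.Ring2.SemiregularRepresentatives

end
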